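import Summits.Ventures.PercRepro.RankLevelSetHallForm

/-!
# PercRepro — C-044, the UP form at the tight layer REDUCES TO AN INJECTION (♠′) (night-1, gen 13)

At the tight layer `|E| = p + q` the UP-Hall condition of C-044 (`HallUpC025` at this layer) follows from the
upward Boolean LYM bound plus ONE combinatorial statement about the rank-`q` supersets of members:

* `rankqOver M p q` (ℛ): the sets `S ⊆ E` with `r(S) = q`, `q + 1 ≤ |S| ≤ p − 1`, containing a member of the cell —
  exactly the supersets of members that the upward LYM count produces but that are NOT in `Y` (their rank is `q`);
* `bigMid M p q` (𝒞): the sets `T ⊆ E` with `q < r(T) < p` and `|T| ≥ p` — in `Y`, but invisible to the LYM count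
  at the levels `q < u < p`;
* `SpadeInjection M p q` (♠′): an injection `φ : ℛ → 𝒞` with `S ⊆ φ S`.

**`hallUp_of_ncard_eq_of_spade`**: `|E| = p + q` and (♠′) ⇒ for every family `𝒜` of members,
`Φ(p,q)·#𝒜 ≤ #(UP-neighbourhood of 𝒜)`.  Proof: the `u`-supersets of `𝒜` (`q < u < p`) number at least
`C(n,u)/C(n,q)·#𝒜` at each level (the DOWN shadow bound `choose_mul_card_le_choose_mul_card_shadow` of
RankLevelSetHallTight applied to the complements `E ∖ Z`, which are `p`-sets); a superset of size `u < p` has rank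
`< p`, and rank `> q` unless its rank is exactly `q`, in which case it lies in ℛ and `φ` sends it injectively to a
set of `𝒞` above the same member, of size `≥ p` — disjoint from the level sets.  Summing the levels gives
`Φ(p,q)·#𝒜` (`phiK p q = Σ_{q<u<p} C(p+q,u) / C(p+q,p)`, and `C(p+q,p) = C(p+q,q)`).

Census (night-1 g13, own exact code, dossier §23): (♠′) holds — a perfect matching ℛ → 𝒞 exists — on every loopless
matroid at the tight layer with `n ≤ 9` and on the three witnesses that kill its two natural fractional
certificates (the degree rule of §22.11 at `(6,4)` `n = 10` / `(8,6)` `n = 14`, the proportional rule at `(7,5)`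
`n = 12`); it is NOT proved.  Axioms: standard.
-/

namespace PercRepro

open Set Matroid Finset

variable {α : Type} (M : Matroid α) [M.Finite]

/-- ℛ: the rank-`q` sets of size `q + 1 … p − 1` that contain a member of the cell `(p,q)`. -/
def rankqOver (M : Matroid α) (p q : ℕ) : Set (Set α) :=
  {S : Set α | S ⊆ M.E ∧ M.eRk S = (q : ℕ∞) ∧ q + 1 ≤ S.ncard ∧ S.ncard ≤ p - 1 ∧
    ∃ Z ∈ cellMembers M p q, Z ⊆ S}

/-- 𝒞: the sets of `Y(p,q)` of size at least `p`. -/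
def bigMid (M : Matroid α) (p q : ℕ) : Set (Set α) :=
  {T : Set α | T ⊆ M.E ∧ (q : ℕ∞) < M.eRk T ∧ M.eRk T < (p : ℕ∞) ∧ p ≤ T.ncard}

/-- **(♠′)**: an injection `φ : ℛ → 𝒞` with `S ⊆ φ S`. -/
def SpadeInjection (M : Matroid α) (p q : ℕ) : Prop :=
  ∃ φ : Set α → Set α, Set.InjOn φ (rankqOver M p q) ∧
    ∀ S ∈ rankqOver M p q, φ S ∈ bigMid M p q ∧ S ⊆ φ S

/-- **C-044, UP FORM, AT THE TIGHT LAYER, MODULO (♠′)**: if `|E| = p + q` and an injection (♠′) exists, then every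
family `𝒜` of members of the cell has at least `Φ(p,q)·#𝒜` UP-neighbours. -/
theorem hallUp_of_ncard_eq_of_spade (p q : ℕ) (hE : M.E.ncard = p + q) (hsp : SpadeInjection M p q)
    (𝒜 : Set (Set α)) (h𝒜 : 𝒜 ⊆ cellMembers M p q) :
    phiK p q * (𝒜.ncard : ℚ) ≤ ((upNbhd M p q 𝒜).ncard : ℚ) := by
  classical
  obtain ⟨φ, hφinj, hφ⟩ := hsp
  have hEfin : M.E.Finite := M.set_finite M.E
  set Ef : Finset α := hEfin.toFinset with hEf
  have hEcard : Ef.card = M.E.ncard := (ncard_eq_toFinset_card _ hEfin).symm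
  have hEcoe : (Ef : Set α) = M.E := by simp [hEf]
  have h𝒜fin : 𝒜.Finite := hEfin.finite_subsets.subset (fun Z hZ => (h𝒜 hZ).1)
  -- the complement `E ∖ Z` as a finset
  have hcoe : ∀ Z : Set α, ((Ef.filter (fun x => x ∉ Z) : Finset α) : Set α) = M.E \ Z := by
    intro Z
    ext x
    simp [Finset.coe_filter, hEf, hEfin.mem_toFinset]
  set ℬ : Finset (Finset α) := h𝒜fin.toFinset.image (fun Z => Ef.filter (fun x => x ∉ Z)) with hℬdef
  have hℬcard : ℬ.card = 𝒜.ncard := by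
    rw [hℬdef, Finset.card_image_of_injOn, ncard_eq_toFinset_card _ h𝒜fin]
    intro Z₁ hZ₁ Z₂ hZ₂ hEq
    rw [Finset.mem_coe, h𝒜fin.mem_toFinset] at hZ₁ hZ₂
    have hc : ((Ef.filter (fun x => x ∉ Z₁) : Finset α) : Set α) =
        ((Ef.filter (fun x => x ∉ Z₂) : Finset α) : Set α) := by
      simp only at hEq
      rw [hEq]
    rw [hcoe, hcoe] at hc
    have h1 := (h𝒜 hZ₁).1
    have h2 := (h𝒜 hZ₂).1
    calc Z₁ = M.E \ (M.E \ Z₁) := (Set.sdiff_sdiff_cancel_left h1).symm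
      _ = M.E \ (M.E \ Z₂) := by rw [hc]
      _ = Z₂ := Set.sdiff_sdiff_cancel_left h2
  have hℬ : ∀ B ∈ ℬ, B ⊆ Ef ∧ B.card = p := by
    intro B hB
    rw [hℬdef, Finset.mem_image] at hB
    obtain ⟨Z, hZ, rfl⟩ := hB
    rw [h𝒜fin.mem_toFinset] at hZ
    obtain ⟨-, hAcard⟩ := compl_indep_of_mem_U M hE (h𝒜 hZ)
    refine ⟨Finset.filter_subset _ _, ?_⟩
    rw [← ncard_coe_finset, hcoe, hAcard]
  -- level-`u` supersets of members of `𝒜`, as complements of `(n − u)`-subsets of the complements `E ∖ Z`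
  set n : ℕ := p + q with hn
  set G : Finset (Finset α) :=
    (Finset.Ioo q p).biUnion (fun u => (ℬ.biUnion (fun B => B.powersetCard (n - u))).image (fun X => Ef \ X))
    with hG
  -- every element of `G` at level `u` is an `u`-superset of a member, inside `E`
  have hGmem : ∀ s ∈ G, s ⊆ Ef ∧ q < s.card ∧ s.card < p ∧ ∃ Z ∈ 𝒜, Z ⊆ (s : Set α) := by
    intro s hs
    rw [hG, Finset.mem_biUnion] at hs
    obtain ⟨u, hu, hs⟩ := hs
    rw [Finset.mem_image] at hs
    obtain ⟨X, hX, rfl⟩ := hs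
    rw [Finset.mem_biUnion] at hX
    obtain ⟨B, hB, hX⟩ := hX
    rw [Finset.mem_powersetCard] at hX
    obtain ⟨hXB, hXcard⟩ := hX
    obtain ⟨hBE, hBcard⟩ := hℬ B hB
    rw [Finset.mem_Ioo] at hu
    have hXE : X ⊆ Ef := hXB.trans hBE
    have hcard : (Ef \ X).card = u := by
      rw [Finset.card_sdiff_of_subset hXE, hEcard, hE, hXcard]
      omega
    refine ⟨Finset.sdiff_subset, by omega, by omega, ?_⟩
    have hB' := hB
    rw [hℬdef, Finset.mem_image] at hB'
    obtain ⟨Z, hZ, rfl⟩ := hB'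
    rw [h𝒜fin.mem_toFinset] at hZ
    refine ⟨Z, hZ, ?_⟩
    intro x hx
    rw [Finset.coe_sdiff, Set.mem_sdiff, hEcoe]
    refine ⟨(h𝒜 hZ).1 hx, ?_⟩
    intro hxX
    have hxB := hXB hxX
    rw [Finset.mem_filter] at hxB
    exact hxB.2 hx
  -- `#G = Σ_u #(shadow at level n − u)`
  have hGcard : G.card = ∑ u ∈ Finset.Ioo q p, (ℬ.biUnion (fun B => B.powersetCard (n - u))).card := by
    rw [hG, Finset.card_biUnion]
    · refine Finset.sum_congr rfl (fun u _ => ?_)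
      apply Finset.card_image_of_injOn
      intro X₁ hX₁ X₂ hX₂ hEq
      rw [Finset.mem_coe, Finset.mem_biUnion] at hX₁ hX₂
      obtain ⟨B₁, hB₁, hX₁⟩ := hX₁
      obtain ⟨B₂, hB₂, hX₂⟩ := hX₂
      have h₁ : X₁ ⊆ Ef := (Finset.mem_powersetCard.1 hX₁).1.trans (hℬ B₁ hB₁).1
      have h₂ : X₂ ⊆ Ef := (Finset.mem_powersetCard.1 hX₂).1.trans (hℬ B₂ hB₂).1
      simp only at hEq
      calc X₁ = Ef \ (Ef \ X₁) := (Finset.sdiff_sdiff_eq_self h₁).symm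
        _ = Ef \ (Ef \ X₂) := by rw [hEq]
        _ = X₂ := Finset.sdiff_sdiff_eq_self h₂
    · intro u hu v hv huv
      change Disjoint _ _
      rw [Finset.disjoint_left]
      intro s hs hs'
      rw [Finset.mem_image] at hs hs'
      obtain ⟨X, hX, rfl⟩ := hs
      obtain ⟨X', hX', hEq⟩ := hs'
      rw [Finset.mem_biUnion] at hX hX'
      obtain ⟨B, hB, hX⟩ := hX
      obtain ⟨B', hB', hX'⟩ := hX'
      rw [Finset.mem_powersetCard] at hX hX'
      have h₁ : X ⊆ Ef := hX.1.trans (hℬ B hB).1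
      have h₂ : X' ⊆ Ef := hX'.1.trans (hℬ B' hB').1
      have hc₁ : (Ef \ X).card = Ef.card - (n - u) := by rw [Finset.card_sdiff_of_subset h₁, hX.2]
      have hc₂ : (Ef \ X').card = Ef.card - (n - v) := by rw [Finset.card_sdiff_of_subset h₂, hX'.2]
      rw [hEq] at hc₂
      rw [hEcard, hE] at hc₁ hc₂
      rw [Finset.mem_coe, Finset.mem_Ioo] at hu hv
      exact huv (by omega)
  -- the map into the UP-neighbourhood: coercion on the rank-`> q` sets, `φ` on the rank-`q` sets
  set ψ : Finset α → Set α := fun s => if M.eRk (s : Set α) = (q : ℕ∞) then φ (s : Set α) else (s : Set α)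
    with hψ
  have hrkge : ∀ s ∈ G, (q : ℕ∞) ≤ M.eRk (s : Set α) := by
    intro s hs
    obtain ⟨-, -, -, Z, hZ, hZs⟩ := hGmem s hs
    have := (h𝒜 hZ).2.1
    rw [← this]
    exact M.eRk_mono hZs
  have hrklt : ∀ s ∈ G, M.eRk (s : Set α) < (p : ℕ∞) := by
    intro s hs
    obtain ⟨-, -, hsp, -⟩ := hGmem s hs
    calc M.eRk (s : Set α) ≤ (s : Set α).encard := M.eRk_le_encard _
      _ = (s.card : ℕ∞) := encard_coe_eq_coe_finsetCard s
      _ < (p : ℕ∞) := by exact_mod_cast hsp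
  have hsubE : ∀ s ∈ G, (s : Set α) ⊆ M.E := by
    intro s hs
    have := (hGmem s hs).1
    rw [← hEcoe]
    exact_mod_cast this
  have hinR : ∀ s ∈ G, M.eRk (s : Set α) = (q : ℕ∞) → (s : Set α) ∈ rankqOver M p q := by
    intro s hs hq
    obtain ⟨-, hqs, hsp, Z, hZ, hZs⟩ := hGmem s hs
    refine ⟨hsubE s hs, hq, ?_, ?_, Z, h𝒜 hZ, hZs⟩
    · rw [ncard_coe_finset]; omega
    · rw [ncard_coe_finset]; omega
  have hψmem : ∀ s ∈ G, ψ s ∈ upNbhd M p q 𝒜 := by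
    intro s hs
    obtain ⟨-, -, -, Z, hZ, hZs⟩ := hGmem s hs
    simp only [hψ]
    split_ifs with hq
    · obtain ⟨hT, hsT⟩ := hφ _ (hinR s hs hq)
      exact ⟨hT.1, hT.2.1, hT.2.2.1, Z, hZ, hZs.trans hsT⟩
    · refine ⟨hsubE s hs, lt_of_le_of_ne (hrkge s hs) (Ne.symm hq), hrklt s hs, Z, hZ, hZs⟩
  have hψinj : Set.InjOn ψ (G : Set (Finset α)) := by
    intro s₁ hs₁ s₂ hs₂ hEq
    rw [Finset.mem_coe] at hs₁ hs₂
    simp only [hψ] at hEq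
    have hbig : ∀ s ∈ G, M.eRk (s : Set α) = (q : ℕ∞) → p ≤ (φ (s : Set α)).ncard := by
      intro s hs hq
      exact (hφ _ (hinR s hs hq)).1.2.2.2
    have hsmall : ∀ s ∈ G, (s : Set α).ncard < p := by
      intro s hs
      rw [ncard_coe_finset]
      exact (hGmem s hs).2.2.1
    split_ifs at hEq with h₁ h₂ h₂
    · exact Finset.coe_injective (hφinj (hinR s₁ hs₁ h₁) (hinR s₂ hs₂ h₂) hEq)
    · exfalso
      have := hbig s₁ hs₁ h₁
      rw [hEq] at this
      exact absurd this (not_le.2 (hsmall s₂ hs₂))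
    · exfalso
      have := hbig s₂ hs₂ h₂
      rw [← hEq] at this
      exact absurd this (not_le.2 (hsmall s₁ hs₁))
    · exact Finset.coe_injective hEq
  have hUfin : (upNbhd M p q 𝒜).Finite := hEfin.finite_subsets.subset (fun S hS => hS.1)
  have hGU : ((G : Set (Finset α))).ncard ≤ (upNbhd M p q 𝒜).ncard :=
    ncard_le_ncard_of_injOn ψ (fun s hs => hψmem s (Finset.mem_coe.1 hs)) hψinj hUfin
  rw [ncard_coe_finset, hGcard] at hGU
  -- the binomial bound at every level, summed: `C(n,u)·#ℬ ≤ C(n,p)·#(shadow at level n − u)`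
  have hbin : (∑ u ∈ Finset.Ioo q p, (p + q).choose u) * ℬ.card ≤
      (p + q).choose p * ∑ u ∈ Finset.Ioo q p, (ℬ.biUnion (fun B => B.powersetCard (n - u))).card := by
    rw [Finset.sum_mul, Finset.mul_sum]
    refine Finset.sum_le_sum (fun u hu => ?_)
    rw [Finset.mem_Ioo] at hu
    have h := choose_mul_card_le_choose_mul_card_shadow Ef ℬ p (n - u) (by omega) hℬ
    rw [hEcard, hE] at h
    have hsym : (p + q).choose (n - u) = (p + q).choose u := by
      rw [hn]
      exact Nat.choose_symm (by omega)
    rw [hsym] at h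
    exact h
  have hchoose : (0 : ℚ) < ((p + q).choose p : ℚ) := by
    exact_mod_cast Nat.choose_pos (by omega)
  have hmain : phiK p q * (ℬ.card : ℚ) ≤
      ((∑ u ∈ Finset.Ioo q p, (ℬ.biUnion (fun B => B.powersetCard (n - u))).card : ℕ) : ℚ) := by
    unfold phiK
    rw [div_mul_eq_mul_div, div_le_iff₀ hchoose]
    have h' : ((∑ u ∈ Finset.Ioo q p, (p + q).choose u : ℕ) : ℚ) * (ℬ.card : ℚ) ≤
        ((p + q).choose p : ℚ) *
          ((∑ u ∈ Finset.Ioo q p, (ℬ.biUnion (fun B => B.powersetCard (n - u))).card : ℕ) : ℚ) := by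
      exact_mod_cast hbin
    push_cast at h' ⊢
    linarith
  rw [← hℬcard]
  calc phiK p q * (ℬ.card : ℚ)
      ≤ ((∑ u ∈ Finset.Ioo q p, (ℬ.biUnion (fun B => B.powersetCard (n - u))).card : ℕ) : ℚ) := hmain
    _ ≤ ((upNbhd M p q 𝒜).ncard : ℚ) := by exact_mod_cast hGU

end PercRepro
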